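import Mathlib
import HarnessLib

/-!
# Minkowski's bound: a prime dividing the order of a finite subgroup of `GL_r(ℤ)` is `≤ r + 1`

Stub `stub_minkowski` of line `Sketch` (isotypic–Minkowski reduction) of crux U
`Summit.ABC.ABC.Theses.IsogenyGlueCongruence.EllipticGluingPrimeBound` (stmt-ABC-13919).

Minkowski (1887): if a prime `ℓ` divides the order of a finite subgroup `G ≤ GL_r(ℤ)`, then
`ℓ ≤ r + 1`.  Proof: Cauchy's theorem gives `g ∈ G` of order `ℓ`; viewing `g` as a rational
matrix `M` we get `M ^ ℓ = 1` and `M ≠ 1`, so the minimal polynomial of `M` over `ℚ` divides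
`X ^ ℓ - 1 = Φ_ℓ · (X - 1)` but not `X - 1`; as `Φ_ℓ` is irreducible over `ℚ`, it divides the
minimal polynomial, hence the characteristic polynomial (of degree `r`), so
`ℓ - 1 = deg Φ_ℓ ≤ r`.  Pure Mathlib; no cited facts.
-/

-- `Summit.<Summit>.<Problem>` is the mandated summit-side namespace (CONVENTIONS §2); for the
-- single-conjunct summit `ABC` the two coincide, so the duplicate `ABC.ABC` is deliberate.
set_option linter.dupNamespace false

namespace Summit.ABC.ABC.Theorems.IsotypicMinkowski

open Polynomial

/-- Field-level core of Minkowski's bound: a rational `r × r` matrix `M` with `M ^ ℓ = 1` and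
`M ≠ 1`, `ℓ` prime, forces `ℓ ≤ r + 1` (the `ℓ`-th cyclotomic polynomial, irreducible over `ℚ`
of degree `ℓ - 1`, divides the minimal and hence the characteristic polynomial of `M`). -/
theorem prime_le_succ_of_matrix_pow_eq_one {r ℓ : ℕ} (hℓ : ℓ.Prime)
    (M : Matrix (Fin r) (Fin r) ℚ) (hpow : M ^ ℓ = 1) (hne : M ≠ 1) : ℓ ≤ r + 1 := by
  haveI := Fact.mk hℓ
  -- the minimal polynomial divides `X ^ ℓ - 1 = Φ_ℓ * (X - 1)`
  have hdvd : minpoly ℚ M ∣ cyclotomic ℓ ℚ * (X - 1) := by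
    rw [cyclotomic_prime_mul_X_sub_one]
    refine minpoly.dvd ℚ M ?_
    simp [hpow]
  have hirr : Irreducible (cyclotomic ℓ ℚ) := cyclotomic.irreducible_rat hℓ.pos
  -- `Φ_ℓ` divides the minimal polynomial, for otherwise `minpoly ∣ X - 1`, i.e. `M = 1`
  have hcyc : cyclotomic ℓ ℚ ∣ minpoly ℚ M := by
    by_contra h
    have hcop : IsCoprime (minpoly ℚ M) (cyclotomic ℓ ℚ) :=
      (hirr.coprime_iff_not_dvd.mpr h).symm
    have hX : minpoly ℚ M ∣ X - 1 := hcop.dvd_of_dvd_mul_left hdvd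
    have h0 : aeval M (X - 1 : ℚ[X]) = 0 :=
      aeval_eq_zero_of_dvd_aeval_eq_zero hX (minpoly.aeval ℚ M)
    apply hne
    rwa [map_sub, aeval_X, map_one, sub_eq_zero] at h0
  -- degrees: `ℓ - 1 = deg Φ_ℓ ≤ deg (charpoly M) = r`
  have hchar : cyclotomic ℓ ℚ ∣ M.charpoly := hcyc.trans (Matrix.minpoly_dvd_charpoly M)
  have hdeg := natDegree_le_of_dvd hchar (Matrix.charpoly_monic M).ne_zero
  rw [natDegree_cyclotomic, Nat.totient_prime hℓ, Matrix.charpoly_natDegree_eq_dim,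
    Fintype.card_fin] at hdeg
  have h2 := hℓ.two_le
  omega

/-- **Minkowski (1887).** A prime `ℓ` dividing the order of a finite subgroup `G` of `GL_r(ℤ)`
satisfies `ℓ ≤ r + 1`: Cauchy's theorem gives an element of `G` of order `ℓ`, whose image in
`M_r(ℚ)` (under the injective hom `G ↪ GL_r(ℤ) ↪ M_r(ℤ) ↪ M_r(ℚ)`) still has order `ℓ`, and
`prime_le_succ_of_matrix_pow_eq_one` applies. -/
theorem stub_minkowski (r ℓ : ℕ) (hℓ : ℓ.Prime)
    (G : Subgroup (Matrix.GeneralLinearGroup (Fin r) ℤ)) [Finite G] (hdiv : ℓ ∣ Nat.card G) :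
    ℓ ≤ r + 1 := by
  haveI := Fact.mk hℓ
  obtain ⟨x, hx⟩ := exists_prime_orderOf_dvd_card' ℓ hdiv
  -- the injective monoid hom `G → GL_r(ℤ) → M_r(ℤ) → M_r(ℚ)`
  let φ : G →* Matrix (Fin r) (Fin r) ℚ :=
    ((Int.castRingHom ℚ).mapMatrix.toMonoidHom.comp (Units.coeHom _)).comp G.subtype
  have hφ : Function.Injective φ := fun a b hab ↦
    Subtype.ext <| Units.ext <| Matrix.map_injective (Int.cast_injective (α := ℚ)) hab
  have hord : orderOf (φ x) = ℓ := (orderOf_injective φ hφ x).trans hx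
  refine prime_le_succ_of_matrix_pow_eq_one hℓ (φ x) ?_ ?_
  · rw [← hord]
    exact pow_orderOf_eq_one (φ x)
  · intro h1
    rw [h1, orderOf_one] at hord
    exact hℓ.one_lt.ne hord

end Summit.ABC.ABC.Theorems.IsotypicMinkowski
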